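import Literature.MathematicalPhysics.QuantumFieldTheory.Balaban1983to89.BlockAveragingEMLHaarAC
import Literature.MathematicalPhysics.QuantumFieldTheory.Balaban1983to89.T3UnitLawDensityEML

/-!
# E6′ FAILS FIBREWISE: the one-variable law of Bałaban's (0.4)/`ℰp` block averaging in its private coordinate is NOT Haar

Support file for `Summit.QuantumFields.YangMills.Theses.UnitScaleTilt.HistoryTailL` (stmt-QuantumFields-19936; fleet unit
ym-ust-18916-p1 g4, finding F-g4-1 `FINDING-19936-g4-E6prime.md` §2).  Companion of `…Theorems.HaarForest` (E6′ holds on forests).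

The tree's one-variable normal form of (0.4) (`BlockAveragingEMLHaarAC.avgFun_update_centralBond_self`,
`map_haar_avgFun_update_eq`): varying only the private coordinate `g = U(β(c))` (the central crossing bond of the line of the
coarse bond `c`), the coarse variable is `Ū′(c) = fibreMap (pre·g·post)`, and its law under Haar in `g` is `(fibreMap)_* haar`,
`fibreMap W = ℰ.avg(fibreFamily W)·W` on the guard and `W` off it.  EXACT Haar compatibility `Ū_*(dU) = dV`
(`T3AlphaInputsACTrivEnvelope.HaarCompatT3`) would follow fibrewise if `(fibreMap)_* haar = haar` for (almost) every outer
configuration — as it does for the axial averaging (`fibreMap` = a translate).  THIS FILE SHOWS IT FAILS for the printed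
exp-mean-log average `ℰp` on `SU(2)` already at the FLAT configuration `U ≡ 1`:

* §1 at `U ≡ 1` every open holonomy is `1`, the W-coordinate family is `(1 central, W⁻¹ off-central)`, the guard is the ball
  `dist1 W < 1/3` (`mem_fibreGuard_one_iff`);
* §2 COUNT: the central indices are `Fin L × S_d × S_d` inside `Idx P = (Fin d → Fin L) × S_d × S_d`, so the central weight is
  `L^{1-d} ≤ 1/3` (`d ≥ 2`, `L ≥ 3`): `3 · N_c ≤ |Idx|` (`three_mul_card_central_le`);
* §3 on the guard `fibreMap W = exp((1 − θ)·log W)` with `θ = (|Idx| − N_c)/|Idx| ≥ 2/3` — ONE DAMPED KARCHER STEP towards `1`,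
  a CONTRACTION of the guard ball: `‖fibreMap W − 1‖ < 3/10` (`norm_fibreMap_one_sub_one_lt`);
* §4 hence the shell `{3/10 < ‖W − 1‖ < 1/3}` — non-empty (the unit quaternion `(35 + 12i)/37`) and open, so of positive Haar
  mass — has ZERO mass under `(fibreMap)_* haar`: **`(haar).map (g ↦ Ū(1[β(c) ↦ g])(c)) ≠ haar`**
  (`map_haar_avgFun_one_update_ne_haar`; `T3` instance `T3.map_haar_blockAvg_one_update_ne_haar`).

So the conditional law of `Ū(c)` given all other fine bonds is not Haar whenever the guard can fire (an open set of outer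
configurations of positive measure around the flat one): exact Haar compatibility of `blockAvg ℰp`, if true at all, is NOT
fibrewise/structural — only the forest part is (HaarForest), the cycle part has no mechanism (finding §3).  Elementary; nothing
of Bałaban's estimates is asserted; not a claim about the mass gap.  No `sorry`, no new definitions besides the explicit
witness, standard axioms.
-/

noncomputable section

namespace Summit.QuantumFields.YangMills.Theorems.HaarFibreDefect

open _root_.MeasureTheory _root_.NormedSpace
open Literature.MathematicalPhysics.QuantumFieldTheory.Balaban1983to89
open Literature.MathematicalPhysics.QuantumFieldTheory.Balaban1983to89.T4Continuum
open Literature.MathematicalPhysics.QuantumFieldTheory.Balaban1983to89.AveragingRT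
open Literature.MathematicalPhysics.QuantumFieldTheory.Balaban1983to89.BlockAveraging
open Literature.MathematicalPhysics.QuantumFieldTheory.Balaban1983to89.BlockAveragingHaarAC
open Literature.MathematicalPhysics.QuantumFieldTheory.Balaban1983to89.BlockAveragingEMLHaarAC
open Literature.MathematicalPhysics.QuantumFieldTheory.Balaban1983to89.ExpMeanLog
open Literature.MathematicalPhysics.QuantumFieldTheory.Balaban1983to89.MatrixLog

/-! ## §1 The flat configuration: holonomies, W-coordinate family, guard -/

section Flat

variable {P : Params} {j : ℕ} {G : Type*} [GaugeGroup G]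

/-- Along any walk the holonomy of the flat configuration `U ≡ 1` is `1`. [folklore] -/
theorem holAt_one (γ : List (LStep P j)) : holAt (fun _ : PBond P j => (1 : G)) γ = 1 := by
  unfold holAt
  induction γ with
  | nil => simp
  | cons s t ih =>
      rw [List.map_cons, List.prod_cons, ih]
      split <;> simp

/-- At `U ≡ 1` every open holonomy `V_i` of (0.4) is `1`. [folklore] -/
theorem openHol_one (c : PBond P (j+1)) (i : Idx P) : openHol (fun _ : PBond P j => (1 : G)) c i = 1 :=
  holAt_one _

/-- At `U ≡ 1` every enumerated off-central holonomy `h_k` is `1`. [folklore] -/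
theorem offHol_one (c : PBond P (j+1)) (k : Fin (offCard c)) : offHol (fun _ : PBond P j => (1 : G)) c k = 1 :=
  openHol_one _ _

/-- At `U ≡ 1` the W-coordinate family is `1` at central and `W⁻¹` at off-central indices. [folklore] -/
theorem fibreFamily_one (c : PBond P (j+1)) (W : G) (i : Idx P) :
    fibreFamily (fun _ : PBond P j => (1 : G)) c W i = if IsCentral c i then 1 else W⁻¹ := by
  unfold fibreFamily
  rw [openHol_one, one_mul]

/-- At `U ≡ 1` the W-coordinate guard reads: `dist1 W < δ` as soon as there is an off-central index. [folklore] -/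
theorem mem_fibreGuard_one_iff (ℰ : LoopAverage G) (c : PBond P (j+1)) (W : G) :
    W ∈ fibreGuard ℰ (fun _ : PBond P j => (1 : G)) c ↔ ∀ i : Idx P, ¬ IsCentral c i → dist1 W < ℰ.δ := by
  show (∀ i, dist1 (fibreFamily (fun _ : PBond P j => (1 : G)) c W i) < ℰ.δ) ↔ _
  refine ⟨fun h i hi => ?_, fun h i => ?_⟩
  · have := h i
    rwa [fibreFamily_one, if_neg hi, GaugeGroup.dist1_inv] at this
  · rw [fibreFamily_one]
    by_cases hi : IsCentral c i
    · rw [if_pos hi, GaugeGroup.dist1_one]; exact ℰ.δ_pos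
    · rw [if_neg hi, GaugeGroup.dist1_inv]; exact h i hi

end Flat

/-! ## §2 Counting the central indices: `N_c = L · (d!)²`, `|Idx| = L^d · (d!)²`, so `3 N_c ≤ |Idx|` for `d ≥ 2` -/

section Count

variable {P : Params} {j : ℕ}

/-- `off r ν = 0` iff the `ν`-th block coordinate is the middle one. [folklore] -/
theorem off_eq_zero_iff (r : Fin P.d → Fin P.L) (ν : Fin P.d) :
    off r ν = 0 ↔ r ν = ⟨(P.L - 1) / 2, half_lt P⟩ := by
  rw [Fin.ext_iff]
  simp only [off]
  omega

/-- `N_c = L · |S_d|²`: the central indices at `c` are `Fin L × S_d × S_d` (free longitudinal coordinate, both orderings).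
[folklore] -/
theorem card_central (c : PBond P (j+1)) :
    Fintype.card {i : Idx P // IsCentral c i} = P.L * (Fintype.card (Equiv.Perm (Fin P.d))) ^ 2 := by
  let e : {i : Idx P // IsCentral c i} ≃ Fin P.L × Equiv.Perm (Fin P.d) × Equiv.Perm (Fin P.d) :=
    { toFun := fun i => (i.1.1 c.dir, i.1.2.1, i.1.2.2)
      invFun := fun t => ⟨(Function.update (fun _ => ⟨(P.L - 1) / 2, half_lt P⟩) c.dir t.1, t.2.1, t.2.2),
        fun ν hν => by
          rw [off_eq_zero_iff]
          show Function.update (fun _ => (⟨(P.L - 1) / 2, half_lt P⟩ : Fin P.L)) c.dir t.1 ν = _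
          rw [Function.update_of_ne hν]⟩
      left_inv := fun i => by
        obtain ⟨⟨r, σ, σ'⟩, hi⟩ := i
        apply Subtype.ext
        simp only [Prod.mk.injEq, and_true]
        funext ν
        by_cases hν : ν = c.dir
        · subst hν; rw [Function.update_self]
        · rw [Function.update_of_ne hν]; exact ((off_eq_zero_iff r ν).mp (hi ν hν)).symm
      right_inv := fun t => by
        obtain ⟨t₁, σ, σ'⟩ := t
        simp }
  rw [Fintype.card_congr e, Fintype.card_prod, Fintype.card_prod, Fintype.card_fin, sq]

/-- `|Idx| = L^d · |S_d|²`. [folklore] -/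
theorem card_idx (P : Params) :
    Fintype.card (Idx P) = P.L ^ P.d * (Fintype.card (Equiv.Perm (Fin P.d))) ^ 2 := by
  rw [Fintype.card_prod, Fintype.card_prod, Fintype.card_fun, Fintype.card_fin, Fintype.card_fin, sq]

/-- **`3 · N_c ≤ |Idx|`** for `d ≥ 2` (`L ≥ 3`): the central weight of (0.4) is `L^{1-d} ≤ 1/3`. [folklore] -/
theorem three_mul_card_central_le (hd : 2 ≤ P.d) (c : PBond P (j+1)) :
    3 * Fintype.card {i : Idx P // IsCentral c i} ≤ Fintype.card (Idx P) := by
  rw [card_central, card_idx]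
  have hL : 3 ≤ P.L := by have := P.hL.2; obtain ⟨k, hk⟩ := P.hL.1; omega
  obtain ⟨e, he⟩ := Nat.exists_eq_add_of_le hd
  have hpow : 3 * P.L ≤ P.L ^ P.d := by
    rw [he, show 2 + e = e + 1 + 1 from by ring, pow_succ, pow_succ]
    have h1 : 1 ≤ P.L ^ e := Nat.one_le_pow _ _ (by omega)
    calc 3 * P.L ≤ P.L * P.L := Nat.mul_le_mul_right _ hL
      _ = 1 * P.L * P.L := by ring
      _ ≤ P.L ^ e * P.L * P.L := by gcongr
  calc 3 * (P.L * Fintype.card (Equiv.Perm (Fin P.d)) ^ 2) = 3 * P.L * Fintype.card (Equiv.Perm (Fin P.d)) ^ 2 := by ring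
    _ ≤ P.L ^ P.d * Fintype.card (Equiv.Perm (Fin P.d)) ^ 2 := Nat.mul_le_mul_right _ hpow

/-- `|Idx| − N_c = m` (the off-central count). [folklore] -/
theorem offCard_eq (c : PBond P (j+1)) : offCard c = Fintype.card (Idx P) - Fintype.card {i : Idx P // IsCentral c i} := by
  unfold offCard; exact Fintype.card_subtype_compl _

/-- **The off-central weight is at least `2/3`**: `1 − m/|Idx| ≤ 1/3` for `d ≥ 2`. [folklore] -/
theorem one_sub_offWeight_le (hd : 2 ≤ P.d) (c : PBond P (j+1)) :
    1 - (offCard c : ℝ) * emlWeight P ≤ 1 / 3 := by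
  have hI : (0 : ℝ) < Fintype.card (Idx P) := by exact_mod_cast Fintype.card_pos
  have h3 := three_mul_card_central_le hd c
  have hle : Fintype.card {i : Idx P // IsCentral c i} ≤ Fintype.card (Idx P) := Fintype.card_subtype_le _
  rw [offCard_eq, emlWeight, Nat.cast_sub hle]
  rw [sub_mul, mul_inv_cancel₀ hI.ne']
  have : (Fintype.card {i : Idx P // IsCentral c i} : ℝ) * (Fintype.card (Idx P) : ℝ)⁻¹ ≤ 1 / 3 := by
    rw [← div_eq_mul_inv, div_le_div_iff₀ hI (by norm_num : (0:ℝ) < 3)]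
    exact_mod_cast (by linarith : Fintype.card {i : Idx P // IsCentral c i} * 3 ≤ 1 * Fintype.card (Idx P))
  linarith

/-- There IS an off-central index when `d ≥ 2` (`m > 0`). [folklore] -/
theorem offCard_pos (hd : 2 ≤ P.d) (c : PBond P (j+1)) : 0 < offCard c := by
  have h3 := three_mul_card_central_le hd c
  have hN := Fintype.card_pos (α := {i : Idx P // IsCentral c i}) (h := ⟨⟨(fun _ => ⟨(P.L - 1) / 2, half_lt P⟩, 1, 1),
    fun ν _ => by simp [off]⟩⟩)
  rw [offCard_eq]; omega

/-- An off-central index, chosen. [folklore] -/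
theorem exists_not_isCentral (hd : 2 ≤ P.d) (c : PBond P (j+1)) : ∃ i : Idx P, ¬ IsCentral c i := by
  have h := offCard_pos hd c
  unfold offCard at h
  obtain ⟨i⟩ := Fintype.card_pos_iff.mp h
  exact ⟨i.1, i.2⟩

end Count

/-! ## §3 On `SU(2)`: the fibre map at `U ≡ 1` is the contraction `W ↦ exp((1 − θ) log W)` of the guard ball -/

section SUTwo

open scoped Matrix.Norms.L2Operator

variable {P : Params} {j : ℕ}

/-- At `U ≡ 1` the guard of `(expMeanLogSU (n := Fin 2))` is the ball `‖W − 1‖ < 1/3` (`d ≥ 2`). [folklore] -/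
theorem mem_fibreGuard_one_iff_norm (hd : 2 ≤ P.d) (c : PBond P (j+1)) (W : (Matrix.specialUnitaryGroup (Fin 2) ℂ)) :
    W ∈ fibreGuard (expMeanLogSU (n := Fin 2)) (fun _ : PBond P j => (1 : (Matrix.specialUnitaryGroup (Fin 2) ℂ))) c ↔ ‖(W : Matrix (Fin 2) (Fin 2) ℂ) - 1‖ < 1 / 3 := by
  rw [mem_fibreGuard_one_iff]
  change _ ↔ dist1 W < 1 / 3
  have hδ : ((expMeanLogSU (n := Fin 2))).δ = 1 / 3 := by
    rw [expMeanLogSU_δ, Fintype.card_fin, Nat.cast_ofNat, min_eq_left]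
    rw [le_div_iff₀ (by norm_num : (0:ℝ) < 2)]
    have := Real.pi_gt_three
    linarith
  rw [hδ]
  obtain ⟨i₀, hi₀⟩ := exists_not_isCentral hd c
  exact ⟨fun h => h i₀ hi₀, fun h _ _ => h⟩

/-- **THE FIBRE MAP AT THE FLAT CONFIGURATION IS A DAMPED KARCHER STEP**: on the guard,
`fibreMap W = exp((1 − θ)·log W)`, `θ = m/|Idx|` the off-central weight. [cite: Balaban1987RG1, (0.4) p.253] -/
theorem coe_fibreMap_one (hd : 2 ≤ P.d) (c : PBond P (j+1)) {W : (Matrix.specialUnitaryGroup (Fin 2) ℂ)}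
    (hW : ‖(W : Matrix (Fin 2) (Fin 2) ℂ) - 1‖ < 1 / 3) :
    ((fibreMap (expMeanLogSU (n := Fin 2)) (fun _ : PBond P j => (1 : (Matrix.specialUnitaryGroup (Fin 2) ℂ))) c W : (Matrix.specialUnitaryGroup (Fin 2) ℂ)) : Matrix (Fin 2) (Fin 2) ℂ) =
      exp ((((1 - (offCard c : ℝ) * emlWeight P : ℝ) : ℂ)) • mlog (W : Matrix (Fin 2) (Fin 2) ℂ)) := by
  have hmem : W ∈ fibreGuard (expMeanLogSU (n := Fin 2)) (fun _ : PBond P j => (1 : (Matrix.specialUnitaryGroup (Fin 2) ℂ))) c := (mem_fibreGuard_one_iff_norm hd c W).mpr hW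
  rw [fibreMap_of_mem _ _ _ hmem, coe_fibreCore_eq _ c hmem]
  -- the off-central holonomies are `1`
  have hsum : ∑ k : Fin (offCard c), ((emlWeight P : ℝ) : ℂ) •
      mlog (((offHol (fun _ : PBond P j => (1 : (Matrix.specialUnitaryGroup (Fin 2) ℂ))) c k : (Matrix.specialUnitaryGroup (Fin 2) ℂ)) : Matrix (Fin 2) (Fin 2) ℂ) *
        star (W : Matrix (Fin 2) (Fin 2) ℂ)) =
      (((offCard c : ℝ) * emlWeight P : ℝ) : ℂ) • mlog (star (W : Matrix (Fin 2) (Fin 2) ℂ)) := by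
    have : ∀ k : Fin (offCard c), ((offHol (fun _ : PBond P j => (1 : (Matrix.specialUnitaryGroup (Fin 2) ℂ))) c k : (Matrix.specialUnitaryGroup (Fin 2) ℂ)) : Matrix (Fin 2) (Fin 2) ℂ) = 1 :=
      fun k => by rw [offHol_one]; rfl
    simp_rw [this, one_mul]
    rw [Finset.sum_const, Finset.card_univ, Fintype.card_fin, ← Nat.cast_smul_eq_nsmul ℂ, smul_smul]
    congr 1
    push_cast; ring
  rw [hsum]
  -- `log W* = − log W` and `W = exp (log W)`
  have hW3 : ‖(W : Matrix (Fin 2) (Fin 2) ℂ) - 1‖ ≤ 1 / 3 := hW.le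
  have hstar : (W : Matrix (Fin 2) (Fin 2) ℂ) * star (W : Matrix (Fin 2) (Fin 2) ℂ) = 1 :=
    Matrix.mem_unitaryGroup_iff.mp W.2.1
  rw [mlog_eq_neg_of_mul_eq_one hstar hW3, smul_neg, ← neg_smul]
  have hexp : exp (mlog (W : Matrix (Fin 2) (Fin 2) ℂ)) = (W : Matrix (Fin 2) (Fin 2) ℂ) :=
    exp_mlog (lt_of_le_of_lt hW3 (by norm_num))
  rw [show exp (-(((offCard c : ℝ) * emlWeight P : ℝ) : ℂ) • mlog (W : Matrix (Fin 2) (Fin 2) ℂ)) * (W : Matrix (Fin 2) (Fin 2) ℂ) =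
      exp (-(((offCard c : ℝ) * emlWeight P : ℝ) : ℂ) • mlog (W : Matrix (Fin 2) (Fin 2) ℂ)) * exp (mlog (W : Matrix (Fin 2) (Fin 2) ℂ)) by
    rw [hexp]]
  letI : NormedAlgebra ℚ (Matrix (Fin 2) (Fin 2) ℂ) := NormedAlgebra.restrictScalars ℚ ℂ (Matrix (Fin 2) (Fin 2) ℂ)
  rw [← exp_add_of_commute (((Commute.refl _).smul_left _))]
  congr 1
  rw [show -(((offCard c : ℝ) * emlWeight P : ℝ) : ℂ) • mlog (W : Matrix (Fin 2) (Fin 2) ℂ) + mlog (W : Matrix (Fin 2) (Fin 2) ℂ) =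
      (-(((offCard c : ℝ) * emlWeight P : ℝ) : ℂ) + 1) • mlog (W : Matrix (Fin 2) (Fin 2) ℂ) by rw [add_smul, one_smul]]
  congr 1
  push_cast; ring

/-- `e^{1/6} < 13/10`. [folklore] -/
theorem exp_one_sixth_lt : Real.exp (1 / 6) < 13 / 10 := by
  have h := Real.abs_exp_sub_one_sub_id_le (x := 1 / 6) (by rw [abs_of_nonneg (by norm_num)]; norm_num)
  have h' := (abs_le.mp h).2
  nlinarith

/-- **THE CONTRACTION**: on the guard ball `‖W − 1‖ < 1/3` the fibre map at `U ≡ 1` lands in the ball `‖· − 1‖ < 3/10`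
(`‖log W‖ ≤ ½`, central weight `≤ ⅓`, `‖e^Y − 1‖ ≤ e^{‖Y‖} − 1 ≤ e^{1/6} − 1`). [folklore] -/
theorem norm_fibreMap_one_sub_one_lt (hd : 2 ≤ P.d) (c : PBond P (j+1)) {W : (Matrix.specialUnitaryGroup (Fin 2) ℂ)}
    (hW : ‖(W : Matrix (Fin 2) (Fin 2) ℂ) - 1‖ < 1 / 3) :
    ‖((fibreMap (expMeanLogSU (n := Fin 2)) (fun _ : PBond P j => (1 : (Matrix.specialUnitaryGroup (Fin 2) ℂ))) c W : (Matrix.specialUnitaryGroup (Fin 2) ℂ)) : Matrix (Fin 2) (Fin 2) ℂ) - 1‖ < 3 / 10 := by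
  rw [coe_fibreMap_one hd c hW]
  set a : ℝ := 1 - (offCard c : ℝ) * emlWeight P with ha
  have ha0 : 0 ≤ a := by
    have := sum_emlWeight_lt_one (P := P) c
    rw [Finset.sum_const, Finset.card_univ, Fintype.card_fin, nsmul_eq_mul] at this
    rw [ha]; linarith
  have ha3 : a ≤ 1 / 3 := one_sub_offWeight_le hd c
  have hX : ‖mlog (W : Matrix (Fin 2) (Fin 2) ℂ)‖ ≤ 1 / 2 := by
    have h1 : ‖(W : Matrix (Fin 2) (Fin 2) ℂ) - 1‖ < 1 := lt_of_lt_of_le hW (by norm_num)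
    refine (norm_mlog_le_div h1).trans ?_
    rw [div_le_iff₀ (by linarith)]
    linarith
  have hY : ‖((a : ℂ)) • mlog (W : Matrix (Fin 2) (Fin 2) ℂ)‖ ≤ 1 / 6 := by
    rw [norm_smul, Complex.norm_real, Real.norm_of_nonneg ha0]
    calc a * ‖mlog (W : Matrix (Fin 2) (Fin 2) ℂ)‖ ≤ (1 / 3) * (1 / 2) := by gcongr
      _ = 1 / 6 := by norm_num
  calc ‖exp (((a : ℂ)) • mlog (W : Matrix (Fin 2) (Fin 2) ℂ)) - 1‖
      ≤ Real.exp ‖((a : ℂ)) • mlog (W : Matrix (Fin 2) (Fin 2) ℂ)‖ - 1 :=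
        Literature.Analysis.Calculus.norm_exp_sub_one_le _
    _ ≤ Real.exp (1 / 6) - 1 := by gcongr
    _ < 3 / 10 := by have := exp_one_sixth_lt; linarith

/-- Off the guard the fibre map is the identity. [folklore] -/
theorem fibreMap_one_of_not_lt (hd : 2 ≤ P.d) (c : PBond P (j+1)) {W : (Matrix.specialUnitaryGroup (Fin 2) ℂ)}
    (hW : ¬ ‖(W : Matrix (Fin 2) (Fin 2) ℂ) - 1‖ < 1 / 3) :
    fibreMap (expMeanLogSU (n := Fin 2)) (fun _ : PBond P j => (1 : (Matrix.specialUnitaryGroup (Fin 2) ℂ))) c W = W :=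
  fibreMap_of_not_mem _ _ _ fun h => hW ((mem_fibreGuard_one_iff_norm hd c W).mp h)

/-! ## §4 The shell `3/10 < ‖W − 1‖ < 1/3`: positive Haar mass, no image mass -/

/-- The shell is open. [folklore] -/
theorem isOpen_shell :
    IsOpen {W : Matrix.specialUnitaryGroup (Fin 2) ℂ |
      3 / 10 < ‖(W : Matrix (Fin 2) (Fin 2) ℂ) - 1‖ ∧ ‖(W : Matrix (Fin 2) (Fin 2) ℂ) - 1‖ < 1 / 3} := by
  have hc : Continuous fun W : (Matrix.specialUnitaryGroup (Fin 2) ℂ) => ‖(W : Matrix (Fin 2) (Fin 2) ℂ) - 1‖ :=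
    (continuous_subtype_val.sub continuous_const).norm
  exact (isOpen_lt continuous_const hc).inter (isOpen_lt hc continuous_const)

/-- The shell is measurable. [folklore] -/
theorem measurableSet_shell :
    MeasurableSet {W : Matrix.specialUnitaryGroup (Fin 2) ℂ |
      3 / 10 < ‖(W : Matrix (Fin 2) (Fin 2) ℂ) - 1‖ ∧ ‖(W : Matrix (Fin 2) (Fin 2) ℂ) - 1‖ < 1 / 3} :=
  isOpen_shell.measurableSet

open Literature.MathematicalPhysics.QuantumLattice (quatMatrix quatMatrix_mem_specialUnitaryGroup) in
open Literature.MathematicalPhysics.QuantumFieldTheory.Balaban1983to89.T4QuatExpLog (norm_quatMatrix_sub_one) in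
open Quaternion in
/-- **The shell is non-empty**: the unit quaternion `q = (35 + 12 i)/37` has `‖q − 1‖² = 4/37 ∈ (9/100, 1/9)`. [folklore] -/
theorem shell_nonempty :
    Set.Nonempty {W : Matrix.specialUnitaryGroup (Fin 2) ℂ |
      3 / 10 < ‖(W : Matrix (Fin 2) (Fin 2) ℂ) - 1‖ ∧ ‖(W : Matrix (Fin 2) (Fin 2) ℂ) - 1‖ < 1 / 3} := by
  let q : ℍ[ℝ] := ⟨35 / 37, 12 / 37, 0, 0⟩
  have hq1 : ‖q‖ = 1 := by
    have h : ‖q‖ * ‖q‖ = 1 := by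
      rw [← Quaternion.normSq_eq_norm_mul_self, Quaternion.normSq_def']
      norm_num [q]
    nlinarith [norm_nonneg q]
  have hq2 : ‖q - 1‖ * ‖q - 1‖ = 4 / 37 := by
    rw [← Quaternion.normSq_eq_norm_mul_self, Quaternion.normSq_def']
    norm_num [q]
  refine ⟨⟨quatMatrix q, quatMatrix_mem_specialUnitaryGroup hq1⟩, ?_, ?_⟩
  · show 3 / 10 < ‖quatMatrix q - 1‖
    rw [norm_quatMatrix_sub_one]
    nlinarith [norm_nonneg (q - 1)]
  · show ‖quatMatrix q - 1‖ < 1 / 3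
    rw [norm_quatMatrix_sub_one]
    nlinarith [norm_nonneg (q - 1)]

/-- **The shell has positive Haar mass** (Haar measure on `SU(2)` charges open sets). [folklore] -/
theorem haar_shell_pos :
    0 < (HaarData.haar : Measure (Matrix.specialUnitaryGroup (Fin 2) ℂ))
      {W : Matrix.specialUnitaryGroup (Fin 2) ℂ |
      3 / 10 < ‖(W : Matrix (Fin 2) (Fin 2) ℂ) - 1‖ ∧ ‖(W : Matrix (Fin 2) (Fin 2) ℂ) - 1‖ < 1 / 3} := by
  haveI : (HaarData.haar : Measure (Matrix.specialUnitaryGroup (Fin 2) ℂ)).IsOpenPosMeasure := by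
    show (Literature.MathematicalPhysics.QuantumFieldTheory.haarProbability (Matrix.specialUnitaryGroup (Fin 2) ℂ)).IsOpenPosMeasure
    unfold Literature.MathematicalPhysics.QuantumFieldTheory.haarProbability; infer_instance
  exact isOpen_shell.measure_pos _ shell_nonempty

/-- **The shell has NO mass under the fibre law at `U ≡ 1`** (its preimage under the fibre map is empty). [folklore] -/
theorem map_fibreMap_one_shell (hd : 2 ≤ P.d) (c : PBond P (j+1)) :
    ((HaarData.haar : Measure (Matrix.specialUnitaryGroup (Fin 2) ℂ)).map
      (fibreMap (expMeanLogSU (n := Fin 2)) (fun _ : PBond P j => (1 : Matrix.specialUnitaryGroup (Fin 2) ℂ)) c))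
      {W : Matrix.specialUnitaryGroup (Fin 2) ℂ |
      3 / 10 < ‖(W : Matrix (Fin 2) (Fin 2) ℂ) - 1‖ ∧ ‖(W : Matrix (Fin 2) (Fin 2) ℂ) - 1‖ < 1 / 3} = 0 := by
  rw [Measure.map_apply (measurable_fibreMap _ measurable_expMeanLogSU_E _ c) measurableSet_shell]
  have hempty : fibreMap (expMeanLogSU (n := Fin 2)) (fun _ : PBond P j => (1 : Matrix.specialUnitaryGroup (Fin 2) ℂ)) c ⁻¹'
      {W : Matrix.specialUnitaryGroup (Fin 2) ℂ |
      3 / 10 < ‖(W : Matrix (Fin 2) (Fin 2) ℂ) - 1‖ ∧ ‖(W : Matrix (Fin 2) (Fin 2) ℂ) - 1‖ < 1 / 3} = ∅ := by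
    ext W
    simp only [Set.mem_preimage, Set.mem_empty_iff_false, iff_false, Set.mem_setOf_eq, not_and]
    intro h1 h2
    by_cases hW : ‖(W : Matrix (Fin 2) (Fin 2) ℂ) - 1‖ < 1 / 3
    · have := norm_fibreMap_one_sub_one_lt hd c hW
      linarith
    · rw [fibreMap_one_of_not_lt hd c hW] at h2
      exact hW h2
  rw [hempty, measure_empty]

/-- **THE FIBRE LAW OF (0.4)/`ℰp` IS NOT HAAR**: `(fibreMap)_* haar ≠ haar` at the flat configuration. [folklore] -/
theorem map_fibreMap_one_ne_haar (hd : 2 ≤ P.d) (c : PBond P (j+1)) :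
    (HaarData.haar : Measure (Matrix.specialUnitaryGroup (Fin 2) ℂ)).map (fibreMap (expMeanLogSU (n := Fin 2)) (fun _ : PBond P j => (1 : (Matrix.specialUnitaryGroup (Fin 2) ℂ))) c) ≠ HaarData.haar := by
  intro h
  have h0 := map_fibreMap_one_shell hd c
  rw [h] at h0
  exact (haar_shell_pos).ne' h0

/-- **E6′ FAILS FIBREWISE (the kernel certificate of finding F-g4-1 §2)**: for Bałaban's (0.4) block averaging with the
printed exp-mean-log average on `SU(2)`, the law of the coarse bond variable `Ū(c)` as a function of its private coordinate
`U(β(c)) ∼ haar` alone, all other fine bonds frozen at the flat configuration, is NOT Haar (standing range, `d ≥ 2`). Hence the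
conditional law of `Ū(c)` given the other fine bonds is not Haar on a set of outer configurations of positive measure, and exact
Haar compatibility `Ū_*(dU) = dV`, if it holds, is not a fibrewise identity. [cite: Balaban1987RG1, (0.4) p.253] -/
theorem map_haar_avgFun_one_update_ne_haar [DecidableEq (PBond P j)] (hj : j + 1 ≤ P.m + P.K) (hd : 2 ≤ P.d)
    (c : PBond P (j+1)) :
    (HaarData.haar : Measure (Matrix.specialUnitaryGroup (Fin 2) ℂ)).map
        (fun g => avgFun (expMeanLogSU (n := Fin 2)) (Function.update (fun _ : PBond P j => (1 : (Matrix.specialUnitaryGroup (Fin 2) ℂ))) (centralBond c) g) c) ≠ HaarData.haar := by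
  rw [map_haar_avgFun_update_eq hj _ measurable_expMeanLogSU_E _ c]
  exact map_fibreMap_one_ne_haar hd c

end SUTwo

/-! ## §5 The `T3Family` instance (`d = 3`, the averaging of `HaarCompatT3`) -/

namespace T3

open Literature.MathematicalPhysics.QuantumFieldTheory.Balaban1983to89.T3ContinuumYM3Torus
open Literature.MathematicalPhysics.QuantumFieldTheory.Balaban1983to89.T3UnitLawDensityEML (ℰp)

open scoped Classical in
/-- **At the pinned averaging of every `T3Family`, every approximation `K`, every level of the standing range and every coarse
bond, the one-variable fibre law at the flat configuration is NOT Haar** — the fibrewise form of `HaarCompatT3 F` is false.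
[cite: Balaban1987RG1, (0.4) p.253] -/
theorem map_haar_blockAvg_one_update_ne_haar (F : T3Family) (K j : ℕ) (hj : j + 1 ≤ F.m + K)
    (c : PBond (F.P K) (j + 1)) :
    (HaarData.haar : Measure (Matrix.specialUnitaryGroup (Fin 2) ℂ)).map
        (fun g => BlockAveraging.avgFun (P := F.P K) (j := j) ℰp
          (Function.update (fun _ : PBond (F.P K) j => (1 : Matrix.specialUnitaryGroup (Fin 2) ℂ))
            (BlockAveragingHaarAC.centralBond c) g) c) ≠ HaarData.haar :=
  have hd : 2 ≤ (F.P K).d := by rw [T3Family.P_d]; norm_num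
  map_haar_avgFun_one_update_ne_haar (P := F.P K) hj hd c

end T3

end Summit.QuantumFields.YangMills.Theorems.HaarFibreDefect

end
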